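import Literature.NumberTheory.DiophantineGeometry.PlaneCurvePointCountProofs
import HarnessLib

/-!
# Rational points of a reducible plane model: factor by factor

Continuation of `PlaneCurvePointCountProofs` (Weil's estimate for the number of rational points of
a possibly singular plane curve over `K = 𝔽_q`). For `Φ ∈ K[X][Y]` monic of degree `d` in `Y`, of
total degree `d` and separable over `K(X)` — not assumed irreducible — with `m` distinct monic
irreducible factors, the number `N(Φ) = #{(a, b) ∈ K² : Φ(a, b) = 0}` of rational points satisfies

  `N(Φ) ≤ m (q + 1) + (d-1)(d-2)√q + d · d(d-1)`   (`card_zeros_le_card_factors_mul`),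

by applying `card_zeros_le_of_irreducible` to each irreducible factor `u` (of degree `d_u`,
`∑ d_u = d`) and summing: `∑ (d_u-1)(d_u-2) ≤ (d-1)(d-2)` and `∑ d_u²(d_u-1) ≤ d²(d-1)`. This is
the upper-bound half of Cafure–Matera's Lemma 5.1 (= Schmidt 1974, Lemma 5) with `ν` replaced by
the number `m ≥ ν` of all `K`-irreducible factors and a cubic lower-order term (sufficient for the
proof of their Thm. 5.2, where planes with `m ≥ 2` are controlled by the effective Bertini
theorem anyway). The inputs about the factors (`natDegree_coeff_add_le_of_mul_eq`: the factors of a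
polynomial of total degree `deg_Y` have total degree `deg_Y`, via multiplicativity of the weighted
degree `max_k (deg_X a_k + k)`) are proved here in general.

No definitions, no new named facts.

## References

* A. Cafure, G. Matera, *Improved explicit estimates on the number of solutions of equations over
  a finite field*, Finite Fields Appl. 12 (2006) 155–185, Lemma 5.1. [CafureMatera2006]
* W. M. Schmidt, *A lower bound for the number of solutions of equations over finite fields*,
  J. reine angew. Math. 274/275 (1975) 310–352, Lemma 5. [Schmidt1974]
-/

noncomputable section

open scoped Classical Polynomial.Bivariate
open Polynomial

namespace Literature.NumberTheory.DiophantineGeometry.AlgFunctionField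

universe u

/-! ### The weighted degree `max_k (deg_X a_k + k)` is additive on products -/

section WDeg

variable {R : Type*} [CommRing R] [IsDomain R]

omit [IsDomain R] in
/-- Subadditivity of the weighted degree: if `deg_X (coeff_k P) + k ≤ m` and
`deg_X (coeff_k Q) + k ≤ n` for all `k`, then `deg_X (coeff_k (PQ)) + k ≤ m + n` whenever
`coeff_k (PQ) ≠ 0`. [folklore] -/
theorem natDegree_coeff_mul_add_le {P Q : R[X][Y]} {m n : ℕ}
    (hP : ∀ k, P.coeff k ≠ 0 → (P.coeff k).natDegree + k ≤ m)
    (hQ : ∀ k, Q.coeff k ≠ 0 → (Q.coeff k).natDegree + k ≤ n) (k : ℕ)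
    (hk : (P * Q).coeff k ≠ 0) : ((P * Q).coeff k).natDegree + k ≤ m + n := by
  -- some term of the convolution is non-zero, so `k ≤ m + n`
  rw [coeff_mul] at hk ⊢
  obtain ⟨x, hx, hx0⟩ := Finset.exists_ne_zero_of_sum_ne_zero hk
  rw [Finset.mem_antidiagonal] at hx
  have hPx : P.coeff x.1 ≠ 0 := fun h ↦ hx0 (by rw [h, zero_mul])
  have hQx : Q.coeff x.2 ≠ 0 := fun h ↦ hx0 (by rw [h, mul_zero])
  have hkle : k ≤ m + n := by have := hP _ hPx; have := hQ _ hQx; omega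
  suffices h : (∑ y ∈ Finset.antidiagonal k, P.coeff y.1 * Q.coeff y.2).natDegree ≤ m + n - k by
    omega
  refine natDegree_sum_le_of_forall_le _ _ fun y hy ↦ ?_
  rw [Finset.mem_antidiagonal] at hy
  by_cases hPy : P.coeff y.1 = 0
  · rw [hPy, zero_mul, natDegree_zero]; exact Nat.zero_le _
  by_cases hQy : Q.coeff y.2 = 0
  · rw [hQy, mul_zero, natDegree_zero]; exact Nat.zero_le _
  have h1 := hP _ hPy
  have h2 := hQ _ hQy
  refine natDegree_mul_le.trans ?_
  omega

/-- **The weighted degree is additive on products** (over a domain). If the weighted degree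
`max_k (deg_X coeff_k + k)` of `P` is exactly `m` and that of `Q` is exactly `n`, then some
coefficient `coeff_k (PQ) ≠ 0` has `deg_X coeff_k (PQ) + k = m + n`: take `k₁`, `k₂` the largest
indices where the maxima are attained; in `coeff_{k₁+k₂} (PQ)` the term `coeff_{k₁} P · coeff_{k₂} Q`
strictly dominates all others in `X`-degree. [folklore] -/
theorem exists_natDegree_coeff_mul_add_eq {P Q : R[X][Y]} {m n : ℕ}
    (hP : ∀ k, P.coeff k ≠ 0 → (P.coeff k).natDegree + k ≤ m)
    (hPm : ∃ k, P.coeff k ≠ 0 ∧ (P.coeff k).natDegree + k = m)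
    (hQ : ∀ k, Q.coeff k ≠ 0 → (Q.coeff k).natDegree + k ≤ n)
    (hQn : ∃ k, Q.coeff k ≠ 0 ∧ (Q.coeff k).natDegree + k = n) :
    ∃ k, (P * Q).coeff k ≠ 0 ∧ ((P * Q).coeff k).natDegree + k = m + n := by
  -- the largest indices attaining the maxima
  set SP := P.support.filter fun k ↦ (P.coeff k).natDegree + k = m with hSP
  set SQ := Q.support.filter fun k ↦ (Q.coeff k).natDegree + k = n with hSQ
  have hSPne : SP.Nonempty := by
    obtain ⟨k, hk, hkm⟩ := hPm
    exact ⟨k, Finset.mem_filter.2 ⟨mem_support_iff.2 hk, hkm⟩⟩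
  have hSQne : SQ.Nonempty := by
    obtain ⟨k, hk, hkn⟩ := hQn
    exact ⟨k, Finset.mem_filter.2 ⟨mem_support_iff.2 hk, hkn⟩⟩
  set k₁ := SP.max' hSPne with hk₁
  set k₂ := SQ.max' hSQne with hk₂
  have hk₁mem : k₁ ∈ SP := Finset.max'_mem _ _
  have hk₂mem : k₂ ∈ SQ := Finset.max'_mem _ _
  rw [Finset.mem_filter, mem_support_iff] at hk₁mem hk₂mem
  -- strict inequality beyond `k₁`, `k₂`
  have hP' : ∀ a, k₁ < a → P.coeff a ≠ 0 → (P.coeff a).natDegree + a < m := by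
    intro a ha ha0
    have hle := hP a ha0
    rcases hle.lt_or_eq with h | h
    · exact h
    · exfalso
      have : a ∈ SP := Finset.mem_filter.2 ⟨mem_support_iff.2 ha0, h⟩
      exact absurd (Finset.le_max' _ _ this) (not_le.2 ha)
  have hQ' : ∀ b, k₂ < b → Q.coeff b ≠ 0 → (Q.coeff b).natDegree + b < n := by
    intro b hb hb0
    have hle := hQ b hb0
    rcases hle.lt_or_eq with h | h
    · exact h
    · exfalso
      have : b ∈ SQ := Finset.mem_filter.2 ⟨mem_support_iff.2 hb0, h⟩
      exact absurd (Finset.le_max' _ _ this) (not_le.2 hb)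
  refine ⟨k₁ + k₂, ?_⟩
  -- the `X`-degree `D` of the dominant term
  set D := (P.coeff k₁).natDegree + (Q.coeff k₂).natDegree with hD
  have hDmn : D + (k₁ + k₂) = m + n := by
    have := hk₁mem.2; have := hk₂mem.2; omega
  -- every other term of the convolution has `X`-degree `< D`
  have hother : ∀ y ∈ Finset.antidiagonal (k₁ + k₂), y ≠ (k₁, k₂) →
      (P.coeff y.1 * Q.coeff y.2).coeff D = 0 := by
    intro y hy hne
    rw [Finset.mem_antidiagonal] at hy
    by_cases hPy : P.coeff y.1 = 0
    · rw [hPy, zero_mul, coeff_zero]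
    by_cases hQy : Q.coeff y.2 = 0
    · rw [hQy, mul_zero, coeff_zero]
    apply coeff_eq_zero_of_natDegree_lt
    refine lt_of_le_of_lt natDegree_mul_le ?_
    rcases lt_trichotomy y.1 k₁ with h | h | h
    · -- `y.1 < k₁`, so `y.2 > k₂`
      have h2 : k₂ < y.2 := by omega
      have := hP _ hPy
      have := hQ' _ h2 hQy
      omega
    · exfalso
      apply hne
      ext
      · exact h
      · simp only; omega
    · have := hP' _ h hPy
      have := hQ _ hQy
      omega
  have hmain : ((P * Q).coeff (k₁ + k₂)).coeff D = (P.coeff k₁).leadingCoeff * (Q.coeff k₂).leadingCoeff := by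
    rw [coeff_mul, finsetSum_coeff,
      Finset.sum_eq_single (k₁, k₂) (fun y hy hne ↦ hother y hy hne)
        (fun h ↦ (h (Finset.mem_antidiagonal.2 rfl)).elim)]
    simp only
    rw [← leadingCoeff_mul, leadingCoeff, natDegree_mul hk₁mem.1 hk₂mem.1]
  have hne0 : ((P * Q).coeff (k₁ + k₂)).coeff D ≠ 0 := by
    rw [hmain]
    exact mul_ne_zero (leadingCoeff_ne_zero.2 hk₁mem.1) (leadingCoeff_ne_zero.2 hk₂mem.1)
  have hcoeff0 : (P * Q).coeff (k₁ + k₂) ≠ 0 := fun h ↦ hne0 (by rw [h, coeff_zero])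
  refine ⟨hcoeff0, le_antisymm (natDegree_coeff_mul_add_le hP hQ _ hcoeff0) ?_⟩
  have : D ≤ ((P * Q).coeff (k₁ + k₂)).natDegree := le_natDegree_of_ne_zero hne0
  omega

/-- **Factors of a plane model of total degree `deg_Y` have total degree `deg_Y`.** If
`Φ = u v ∈ R[X][Y]` with `u`, `v` monic in `Y` and `deg_X (coeff_k Φ) + k ≤ deg_Y Φ` for all `k`
with `coeff_k Φ ≠ 0`, then `deg_X (coeff_k u) + k ≤ deg_Y u` for all `k` with `coeff_k u ≠ 0`. (The
weighted degree of `u` is `≥ deg_Y u` because `u` is monic, similarly for `v`, and their sum is the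
weighted degree `deg_Y Φ` of `Φ`.) [folklore] -/
theorem natDegree_coeff_add_le_of_mul_eq {Φ u v : R[X][Y]} (hu : u.Monic) (hv : v.Monic)
    (h : u * v = Φ) (hΦ : ∀ k, Φ.coeff k ≠ 0 → (Φ.coeff k).natDegree + k ≤ Φ.natDegree) :
    ∀ k, u.coeff k ≠ 0 → (u.coeff k).natDegree + k ≤ u.natDegree := by
  -- weighted degrees `m` of `u` and `n` of `v`
  have hune : u.support.Nonempty := by
    rw [Finset.nonempty_iff_ne_empty, Ne, support_eq_empty]; exact hu.ne_zero
  have hvne : v.support.Nonempty := by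
    rw [Finset.nonempty_iff_ne_empty, Ne, support_eq_empty]; exact hv.ne_zero
  set m := u.support.sup' hune fun k ↦ (u.coeff k).natDegree + k with hm
  set n := v.support.sup' hvne fun k ↦ (v.coeff k).natDegree + k with hn
  have hule : ∀ k, u.coeff k ≠ 0 → (u.coeff k).natDegree + k ≤ m := fun k hk ↦
    Finset.le_sup' (fun k ↦ (u.coeff k).natDegree + k) (mem_support_iff.2 hk)
  have hvle : ∀ k, v.coeff k ≠ 0 → (v.coeff k).natDegree + k ≤ n := fun k hk ↦
    Finset.le_sup' (fun k ↦ (v.coeff k).natDegree + k) (mem_support_iff.2 hk)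
  have hum : ∃ k, u.coeff k ≠ 0 ∧ (u.coeff k).natDegree + k = m := by
    obtain ⟨k, hk, hkm⟩ := Finset.exists_mem_eq_sup' hune fun k ↦ (u.coeff k).natDegree + k
    exact ⟨k, mem_support_iff.1 hk, hkm.symm⟩
  have hvn : ∃ k, v.coeff k ≠ 0 ∧ (v.coeff k).natDegree + k = n := by
    obtain ⟨k, hk, hkn⟩ := Finset.exists_mem_eq_sup' hvne fun k ↦ (v.coeff k).natDegree + k
    exact ⟨k, mem_support_iff.1 hk, hkn.symm⟩
  -- `deg_Y u ≤ m`, `deg_Y v ≤ n` (leading coefficient `1`)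
  have hdu : u.natDegree ≤ m := by
    have := hule u.natDegree (by rw [hu.coeff_natDegree]; exact one_ne_zero)
    omega
  have hdv : v.natDegree ≤ n := by
    have := hvle v.natDegree (by rw [hv.coeff_natDegree]; exact one_ne_zero)
    omega
  -- `m + n ≤ deg_Y Φ = deg_Y u + deg_Y v`
  obtain ⟨k, hk0, hk⟩ := exists_natDegree_coeff_mul_add_eq hule hum hvle hvn
  rw [h] at hk0 hk
  have hmn : m + n ≤ Φ.natDegree := hk ▸ hΦ k hk0
  have hdeg : Φ.natDegree = u.natDegree + v.natDegree := by
    rw [← h, hu.natDegree_mul hv]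
  intro k hk0
  have := hule k hk0
  omega

end WDeg

/-! ### The irreducible factors of a monic separable plane model -/

section Factors

variable {K : Type u} [Field K]

/-- **The monic irreducible factors of a monic separable plane model.** Let `Φ ∈ K[X][Y]` be monic
in `Y`. Every normalised irreducible factor `u` of `Φ` is monic in `Y` (its leading coefficient
divides `1` in `K[X]`). [folklore] -/
theorem monic_of_mem_normalizedFactors {Φ : K[X][Y]} (hm : Φ.Monic) {u : K[X][Y]}
    (hu : u ∈ UniqueFactorizationMonoid.normalizedFactors Φ) : u.Monic := by
  have hdvd : u ∣ Φ := UniqueFactorizationMonoid.dvd_of_mem_normalizedFactors hu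
  have hunit : IsUnit u.leadingCoeff := by
    obtain ⟨w, hw⟩ := hdvd
    have h1 : u.leadingCoeff * w.leadingCoeff = 1 := by
      rw [← leadingCoeff_mul, ← hw, hm.leadingCoeff]
    exact IsUnit.of_mul_eq_one _ h1
  have hnorm : normalize u = u := UniqueFactorizationMonoid.normalize_normalized_factor u hu
  rw [Monic, ← hnorm, leadingCoeff_normalize, normalize_eq_one]
  exact hunit

/-- The normalised irreducible factors of a monic `Φ` have positive degree in `Y` (a factor of
degree `0` would be a unit). [folklore] -/
theorem natDegree_pos_of_mem_normalizedFactors {Φ : K[X][Y]} (hm : Φ.Monic) {u : K[X][Y]}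
    (hu : u ∈ UniqueFactorizationMonoid.normalizedFactors Φ) : 0 < u.natDegree := by
  have hirr : Irreducible u := UniqueFactorizationMonoid.irreducible_of_normalized_factor u hu
  have humon : u.Monic := monic_of_mem_normalizedFactors hm hu
  by_contra h0
  have h0' : u.natDegree = 0 := by omega
  exact hirr.not_isUnit (by rw [eq_one_of_monic_natDegree_zero humon h0']; exact isUnit_one)

/-- For a monic *separable* (over `K(X)`, equivalently squarefree with separable factors)
`Φ ∈ K[X][Y]`, the product of its distinct normalised irreducible factors is `Φ`. [folklore] -/
theorem prod_normalizedFactors_toFinset_eq {Φ : K[X][Y]} (hm : Φ.Monic)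
    (hsep : (Φ.map (algebraMap K[X] (RatFunc K))).Separable) :
    ∏ u ∈ (UniqueFactorizationMonoid.normalizedFactors Φ).toFinset, u = Φ := by
  have hΦ0 : Φ ≠ 0 := hm.ne_zero
  have hsq : Squarefree Φ := by
    have h := hsep.squarefree
    intro z hz
    have hz' : z.map (algebraMap K[X] (RatFunc K)) * z.map (algebraMap K[X] (RatFunc K)) ∣
        Φ.map (algebraMap K[X] (RatFunc K)) := by
      rw [← Polynomial.map_mul]; exact Polynomial.map_dvd _ hz
    have hu := h _ hz'
    -- a polynomial over `K[X]` whose image over `K(X)` is a unit is a constant unit of `K[X][Y]`?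
    -- Not quite (e.g. `z = X`); but `z ∣ Φ` with `Φ` monic forces `z` to have unit leading
    -- coefficient, and a unit over `K(X)` has degree `0`, so `z` is a unit constant.
    have hzdvd : z ∣ Φ := dvd_trans (dvd_mul_right z z) hz
    obtain ⟨w, hw⟩ := hzdvd
    have hlc : IsUnit z.leadingCoeff := by
      have h1 : z.leadingCoeff * w.leadingCoeff = 1 := by
        rw [← leadingCoeff_mul, ← hw, hm.leadingCoeff]
      exact IsUnit.of_mul_eq_one _ h1
    have hdeg0 : (z.map (algebraMap K[X] (RatFunc K))).natDegree = 0 :=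
      natDegree_eq_zero_of_isUnit hu
    rw [natDegree_map_eq_of_injective (IsFractionRing.injective K[X] (RatFunc K))] at hdeg0
    rw [eq_C_of_natDegree_eq_zero hdeg0]
    refine isUnit_C.2 ?_
    have : z.leadingCoeff = z.coeff 0 := by rw [leadingCoeff, hdeg0]
    rw [← this]; exact hlc
  have hnodup : (UniqueFactorizationMonoid.normalizedFactors Φ).Nodup :=
    (UniqueFactorizationMonoid.squarefree_iff_nodup_normalizedFactors hΦ0).1 hsq
  have h1 : ∏ u ∈ (UniqueFactorizationMonoid.normalizedFactors Φ).toFinset, u =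
      (UniqueFactorizationMonoid.normalizedFactors Φ).prod := by
    rw [Finset.prod_eq_multiset_prod, Multiset.toFinset_val, hnodup.dedup, Multiset.map_id']
  rw [h1]
  have hassoc := UniqueFactorizationMonoid.prod_normalizedFactors hΦ0
  have hpm : (UniqueFactorizationMonoid.normalizedFactors Φ).prod.Monic := by
    rw [← h1]
    exact monic_prod_of_monic _ _ fun u hu ↦
      monic_of_mem_normalizedFactors hm (Multiset.mem_toFinset.1 hu)
  exact eq_of_monic_of_associated hpm hm hassoc

/-- The degrees of the distinct irreducible factors of a monic separable `Φ` add up to `deg_Y Φ`.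
[folklore] -/
theorem sum_natDegree_normalizedFactors_toFinset_eq {Φ : K[X][Y]} (hm : Φ.Monic)
    (hsep : (Φ.map (algebraMap K[X] (RatFunc K))).Separable) :
    ∑ u ∈ (UniqueFactorizationMonoid.normalizedFactors Φ).toFinset, u.natDegree = Φ.natDegree := by
  conv_rhs => rw [← prod_normalizedFactors_toFinset_eq hm hsep]
  rw [natDegree_prod_of_monic]
  exact fun u hu ↦ monic_of_mem_normalizedFactors hm (Multiset.mem_toFinset.1 hu)

/-- The number of distinct irreducible factors of a monic separable `Φ` is at most `deg_Y Φ`.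
[folklore] -/
theorem card_normalizedFactors_toFinset_le {Φ : K[X][Y]} (hm : Φ.Monic)
    (hsep : (Φ.map (algebraMap K[X] (RatFunc K))).Separable) :
    (UniqueFactorizationMonoid.normalizedFactors Φ).toFinset.card ≤ Φ.natDegree := by
  rw [← sum_natDegree_normalizedFactors_toFinset_eq hm hsep, Finset.card_eq_sum_ones]
  exact Finset.sum_le_sum fun u hu ↦
    natDegree_pos_of_mem_normalizedFactors hm (Multiset.mem_toFinset.1 hu)

/-- A normalised irreducible factor `u` of a monic `Φ` of total degree `deg_Y Φ` has total degree
`deg_Y u`, in the form `deg_X (coeff_i u) + i ≤ deg_Y u` for `i < deg_Y u`. [folklore] -/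
theorem natDegree_coeff_add_le_of_mem_normalizedFactors {Φ : K[X][Y]} (hm : Φ.Monic)
    (hdeg : ∀ i, i < Φ.natDegree → (Φ.coeff i).natDegree + i ≤ Φ.natDegree) {u : K[X][Y]}
    (hu : u ∈ UniqueFactorizationMonoid.normalizedFactors Φ) :
    ∀ i, i < u.natDegree → (u.coeff i).natDegree + i ≤ u.natDegree := by
  have humon : u.Monic := monic_of_mem_normalizedFactors hm hu
  obtain ⟨w, hw⟩ := UniqueFactorizationMonoid.dvd_of_mem_normalizedFactors hu
  -- normalise the cofactor to be monic
  have hwlc : w.leadingCoeff = 1 := by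
    have h1 : u.leadingCoeff * w.leadingCoeff = 1 := by
      rw [← leadingCoeff_mul, ← hw, hm.leadingCoeff]
    rwa [humon.leadingCoeff, one_mul] at h1
  have hwmon : w.Monic := hwlc
  have hΦ' : ∀ k, Φ.coeff k ≠ 0 → (Φ.coeff k).natDegree + k ≤ Φ.natDegree := fun k hk ↦ by
    rcases lt_trichotomy k Φ.natDegree with h | h | h
    · exact hdeg k h
    · rw [h, hm.coeff_natDegree, natDegree_one, zero_add]
    · exact absurd (coeff_eq_zero_of_natDegree_lt h) hk
  have h := natDegree_coeff_add_le_of_mul_eq humon hwmon hw.symm hΦ'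
  intro i hi
  by_cases hi0 : u.coeff i = 0
  · rw [hi0, natDegree_zero, zero_add]; exact hi.le
  · exact h i hi0

/-- A factor of a polynomial separable over `K(X)` is separable over `K(X)`. [folklore] -/
theorem separable_map_of_dvd {Φ u : K[X][Y]} (hsep : (Φ.map (algebraMap K[X] (RatFunc K))).Separable)
    (hu : u ∣ Φ) : (u.map (algebraMap K[X] (RatFunc K))).Separable :=
  hsep.of_dvd (Polynomial.map_dvd _ hu)

end Factors

/-! ### The count, factor by factor -/

section Count

variable {K : Type u} [Field K] [Fintype K]

/-- `∑ (dᵤ - 1)(dᵤ - 2) ≤ (d - 1)(d - 2)` and `∑ dᵤ²(dᵤ - 1) ≤ d²(d - 1)` for positive integers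
`dᵤ` with `∑ dᵤ = d` (both left sides are termwise at most `(d-2)(dᵤ-1)`, resp. `d²(dᵤ-1)`, and
`∑ (dᵤ - 1) = d - m ≤ d - 1`). [folklore] -/
theorem sum_degree_bounds {ι : Type*} (s : Finset ι) (g : ι → ℕ) (hg : ∀ i ∈ s, 1 ≤ g i)
    (hs : s.Nonempty) :
    ∑ i ∈ s, (g i - 1) * (g i - 2) ≤ (∑ i ∈ s, g i - 1) * (∑ i ∈ s, g i - 2) ∧
      ∑ i ∈ s, g i ^ 2 * (g i - 1) ≤ (∑ i ∈ s, g i) ^ 2 * (∑ i ∈ s, g i - 1) := by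
  set d := ∑ i ∈ s, g i with hd
  have hsub : ∑ i ∈ s, (g i - 1) + s.card = d := by
    rw [Finset.card_eq_sum_ones, ← Finset.sum_add_distrib]
    exact Finset.sum_congr rfl fun i hi ↦ Nat.sub_add_cancel (hg i hi)
  have hcard : 1 ≤ s.card := Finset.card_pos.2 hs
  have hle : ∀ i ∈ s, g i ≤ d := fun i hi ↦ Finset.single_le_sum (fun _ _ ↦ Nat.zero_le _) hi
  constructor
  · calc ∑ i ∈ s, (g i - 1) * (g i - 2) ≤ ∑ i ∈ s, (g i - 1) * (d - 2) :=
          Finset.sum_le_sum fun i hi ↦ Nat.mul_le_mul_left _ (Nat.sub_le_sub_right (hle i hi) 2)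
      _ = (∑ i ∈ s, (g i - 1)) * (d - 2) := (Finset.sum_mul _ _ _).symm
      _ ≤ (d - 1) * (d - 2) := Nat.mul_le_mul_right _ (by omega)
  · calc ∑ i ∈ s, g i ^ 2 * (g i - 1) ≤ ∑ i ∈ s, d ^ 2 * (g i - 1) :=
          Finset.sum_le_sum fun i hi ↦ Nat.mul_le_mul_right _ (Nat.pow_le_pow_left (hle i hi) 2)
      _ = d ^ 2 * ∑ i ∈ s, (g i - 1) := (Finset.mul_sum _ _ _).symm
      _ ≤ d ^ 2 * (d - 1) := Nat.mul_le_mul_left _ (by omega)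

/-- **Upper Weil bound for a reducible plane model, factor by factor (Cafure–Matera's Lemma 5.1,
upper half, with `ν` replaced by the number of irreducible factors).** Let `K = 𝔽_q` and let
`Φ ∈ K[X][Y]` be monic of degree `d` in `Y` with `deg_X (coeff of Yⁱ) + i ≤ d` for `i < d`, and
separable over `K(X)`; let `m` be the number of its distinct monic irreducible factors in
`K[X][Y]`. Then `#{(a, b) ∈ K² : Φ(a, b) = 0} ≤ m(q + 1) + (d-1)(d-2)√q + d · d(d-1)`: every zero
of `Φ` is a zero of one of its irreducible factors `u`, to which `card_zeros_le_of_irreducible`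
applies (`u` is monic of total degree `deg_Y u`, separable over `K(X)`), and the degrees `d_u` of
the factors add up to `d` (`sum_degree_bounds`). [cite: CafureMatera2006, Lemma 5.1] -/
theorem card_zeros_le_card_factors_mul {Φ : K[X][Y]} (hm : Φ.Monic)
    (hdeg : ∀ i, i < Φ.natDegree → (Φ.coeff i).natDegree + i ≤ Φ.natDegree)
    (hsep : (Φ.map (algebraMap K[X] (RatFunc K))).Separable) :
    ((Finset.univ.filter fun p : K × K ↦ Φ.evalEval p.1 p.2 = 0).card : ℝ) ≤
      (UniqueFactorizationMonoid.normalizedFactors Φ).toFinset.card * ((Fintype.card K : ℝ) + 1) +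
        ((Φ.natDegree - 1) * (Φ.natDegree - 2) : ℕ) * √(Fintype.card K : ℝ) +
          (Φ.natDegree * (Φ.natDegree * (Φ.natDegree - 1)) : ℕ) := by
  set S := (UniqueFactorizationMonoid.normalizedFactors Φ).toFinset with hS
  set q : ℝ := (Fintype.card K : ℝ) with hq
  have hmemS : ∀ u ∈ S, u ∈ UniqueFactorizationMonoid.normalizedFactors Φ := fun u hu ↦
    Multiset.mem_toFinset.1 hu
  by_cases hd0 : Φ.natDegree = 0
  · -- `Φ = 1` has no zeros
    have hΦ : Φ = 1 := eq_one_of_monic_natDegree_zero hm hd0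
    have : (Finset.univ.filter fun p : K × K ↦ Φ.evalEval p.1 p.2 = 0) = ∅ :=
      Finset.filter_false_of_mem fun p _ ↦ by rw [hΦ, evalEval_one]; exact one_ne_zero
    rw [this, Finset.card_empty, Nat.cast_zero]
    have h1 : (0 : ℝ) ≤ S.card * (q + 1) := by positivity
    have h2 : (0 : ℝ) ≤ ((Φ.natDegree - 1) * (Φ.natDegree - 2) : ℕ) * √q := by positivity
    have h3 : (0 : ℝ) ≤ ((Φ.natDegree * (Φ.natDegree * (Φ.natDegree - 1)) : ℕ) : ℝ) := by
      positivity
    linarith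
  have hSne : S.Nonempty := by
    rw [Finset.nonempty_iff_ne_empty]
    intro hSe
    have := sum_natDegree_normalizedFactors_toFinset_eq hm hsep
    rw [← hS, hSe, Finset.sum_empty] at this
    exact hd0 this.symm
  -- zeros of `Φ` are zeros of some factor
  have hprod := prod_normalizedFactors_toFinset_eq hm hsep
  have hsub : (Finset.univ.filter fun p : K × K ↦ Φ.evalEval p.1 p.2 = 0) ⊆
      S.biUnion fun u ↦ Finset.univ.filter fun p : K × K ↦ u.evalEval p.1 p.2 = 0 := by
    intro p hp
    rw [Finset.mem_filter] at hp
    rw [Finset.mem_biUnion]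
    have h := hp.2
    rw [← hprod, ← coe_evalEvalRingHom, map_prod, Finset.prod_eq_zero_iff] at h
    obtain ⟨u, hu, hu0⟩ := h
    exact ⟨u, hu, Finset.mem_filter.2 ⟨Finset.mem_univ _, hu0⟩⟩
  have hcard : (Finset.univ.filter fun p : K × K ↦ Φ.evalEval p.1 p.2 = 0).card ≤
      ∑ u ∈ S, (Finset.univ.filter fun p : K × K ↦ u.evalEval p.1 p.2 = 0).card :=
    (Finset.card_le_card hsub).trans Finset.card_biUnion_le
  -- the bound for each factor
  have hfac : ∀ u ∈ S, ((Finset.univ.filter fun p : K × K ↦ u.evalEval p.1 p.2 = 0).card : ℝ) ≤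
      q + 1 + ((u.natDegree - 1) * (u.natDegree - 2) : ℕ) * √q +
        (u.natDegree * (u.natDegree * (u.natDegree - 1)) : ℕ) := by
    intro u hu
    have hu' := hmemS u hu
    exact card_zeros_le_of_irreducible (monic_of_mem_normalizedFactors hm hu')
      (natDegree_coeff_add_le_of_mem_normalizedFactors hm hdeg hu')
      (UniqueFactorizationMonoid.irreducible_of_normalized_factor u hu')
      (separable_map_of_dvd hsep (UniqueFactorizationMonoid.dvd_of_mem_normalizedFactors hu'))
  -- summing
  have hsum : ((Finset.univ.filter fun p : K × K ↦ Φ.evalEval p.1 p.2 = 0).card : ℝ) ≤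
      ∑ u ∈ S, (q + 1 + ((u.natDegree - 1) * (u.natDegree - 2) : ℕ) * √q +
        (u.natDegree * (u.natDegree * (u.natDegree - 1)) : ℕ)) := by
    calc ((Finset.univ.filter fun p : K × K ↦ Φ.evalEval p.1 p.2 = 0).card : ℝ)
        ≤ ∑ u ∈ S, ((Finset.univ.filter fun p : K × K ↦ u.evalEval p.1 p.2 = 0).card : ℝ) := by
          exact_mod_cast hcard
      _ ≤ _ := Finset.sum_le_sum hfac
  rw [Finset.sum_add_distrib, Finset.sum_add_distrib, Finset.sum_const, nsmul_eq_mul,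
    ← Finset.sum_mul] at hsum
  obtain ⟨hb1, hb2⟩ := sum_degree_bounds S (fun u ↦ u.natDegree)
    (fun u hu ↦ natDegree_pos_of_mem_normalizedFactors hm (hmemS u hu)) hSne
  rw [sum_natDegree_normalizedFactors_toFinset_eq hm hsep] at hb1 hb2
  have hb1' : (∑ u ∈ S, (((u.natDegree - 1) * (u.natDegree - 2) : ℕ) : ℝ)) ≤
      ((Φ.natDegree - 1) * (Φ.natDegree - 2) : ℕ) := by
    exact_mod_cast hb1
  have hb2' : (∑ u ∈ S, ((u.natDegree * (u.natDegree * (u.natDegree - 1)) : ℕ) : ℝ)) ≤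
      ((Φ.natDegree * (Φ.natDegree * (Φ.natDegree - 1)) : ℕ) : ℝ) := by
    have h1 : ∑ u ∈ S, u.natDegree * (u.natDegree * (u.natDegree - 1)) ≤
        Φ.natDegree * (Φ.natDegree * (Φ.natDegree - 1)) := by
      have e1 : ∀ u ∈ S, u.natDegree * (u.natDegree * (u.natDegree - 1)) =
          u.natDegree ^ 2 * (u.natDegree - 1) := fun u _ ↦ by ring
      have e2 : Φ.natDegree * (Φ.natDegree * (Φ.natDegree - 1)) =
          Φ.natDegree ^ 2 * (Φ.natDegree - 1) := by ring
      rw [Finset.sum_congr rfl e1, e2]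
      exact hb2
    exact_mod_cast h1
  have hs : 0 ≤ √q := Real.sqrt_nonneg _
  have := mul_le_mul_of_nonneg_right hb1' hs
  push_cast at this hb1' hb2' hsum ⊢
  linarith

end Count

end Literature.NumberTheory.DiophantineGeometry.AlgFunctionField
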